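import Summits.ValiantsHypothesis.ValiantsHypothesis.Theorems.BarrierLeverAnchoredDoorHitsLowerPairsEvalGP

/-!
# Route BarrierLever — support item `AnchoredDoorHitsLowerPairs` (stmt-ValiantsHypothesis-22510), line `anchored_peeling`:
# EVERY PAIR WITH A COMPRESSED SIDE IS HIT — the Frobenius–Vandermonde argument beyond cubes

`…EvalGP` (p723181) proved conjectures GP / E(cube): the binary evaluation door `θ_{bγ} = z_γ^{2^{e b}}` has, modulo 2, the
row-permuted Vandermonde determinant `∏ (σ_j − σ_{j'})` in the distinct subset-sum linear forms `σ_j = Σ_{γ ∈ w j} z_γ` as soon as the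
binary exponents `m_i = Σ_{b ∈ u i} 2^{e b}` of the rows run through `0, …, r − 1`. For cube rows this holds for any labelling; in general it
holds exactly when the row family is COMPRESSED, i.e. an initial segment of the colexicographic order for some injective labelling `e` of
the vertices: `Σ_{b ∈ u i} 2^{e b} < r` for every row `i` (the `r` exponents are then distinct numbers below `r`).

THEOREM (`symbolicDet_ne_zero_of_compressed`): for every `s ≥ 1`, every row family `u` (injective, NOT necessarily a lower set) that is
compressed for some injective labelling, and every injective LOWER column family `w` of the same size, `symbolicDet s h r u w ≠ 0`; and the
swapped statement (`…_swap`: compressed columns, lower rows). Examples beyond the full cube: cube minus its top face (`r = 2^n − 1`), the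
punctured cubes `2^[n−1] ∗ {∅, p, q}` (`r = 3·2^{n−1}`: the colex-initial segment of that length), cube minus the last three faces in colex
(`cube6m3`-type), and every colex-initial family — several of the line's named residual pairs.

WHAT THIS IS NOT: pairs with no compressed side (e.g. `(K_{1,4}, C₄ ⊔ point)`) are not covered; nothing on crux 14610 or `VP ≠ VNP`.
-/

set_option linter.dupNamespace false

namespace Summit.ValiantsHypothesis.ValiantsHypothesis.Theorems.BarrierLever.AnchoredPeeling

open Finset MvPolynomial

noncomputable section

namespace EvalGP

variable {h r : ℕ}

/-- **Frobenius–Vandermonde (mod 2) for COMPRESSED rows.** If `e` is an injective labelling with all binary row exponents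
`Σ_{b ∈ u i} 2^{e b} < r`, then over `𝔽₂[z]` the Frobenius evaluation matrix at `g = X` has nonzero determinant, for ANY injective `w`. -/
theorem det_frob_zmod2_ne_zero_of_compressed (u w : Fin r → Finset (Fin h)) (hu : Function.Injective u)
    (hw : Function.Injective w) (e : Fin h → ℕ) (he : Function.Injective e) (hlt : ∀ i, ∑ b ∈ u i, 2 ^ e b < r) :
    (Matrix.of fun i j : Fin r => ∏ b ∈ u i, ∑ γ ∈ w j, (X γ : MvPolynomial (Fin h) (ZMod 2)) ^ 2 ^ e b).det ≠ 0 := by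
  classical
  set σ : Fin r → MvPolynomial (Fin h) (ZMod 2) := fun j => ∑ γ ∈ w j, X γ with hσ
  set m : Fin r → ℕ := fun i => ∑ b ∈ u i, 2 ^ e b with hm
  have heU : Set.InjOn e ↑(Finset.univ : Finset (Fin h)) := fun _ _ _ _ hab => he hab
  let mFin : Fin r → Fin r := fun i => ⟨m i, hlt i⟩
  have hminj : Function.Injective mFin := by
    intro i i' hii
    have hmm : m i = m i' := by simpa [mFin] using congr_arg Fin.val hii
    exact hu (twoPowSum_injOn heU (Finset.subset_univ _) (Finset.subset_univ _) hmm)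
  have hmbij : Function.Bijective mFin := Finite.injective_iff_bijective.mp hminj
  let π : Equiv.Perm (Fin r) := Equiv.ofBijective mFin hmbij
  have hM : (Matrix.of fun i j : Fin r => ∏ b ∈ u i, ∑ γ ∈ w j, (X γ : MvPolynomial (Fin h) (ZMod 2)) ^ 2 ^ e b) =
      ((Matrix.vandermonde σ).transpose).submatrix π id := by
    ext i j
    rw [Matrix.of_apply, frobEntry_charTwo]
    simp [Matrix.submatrix, Matrix.vandermonde_apply, π, mFin, hm, hσ]
  rw [hM, Matrix.det_permute, Matrix.det_transpose]
  refine mul_ne_zero ?_ ?_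
  · rcases Int.units_eq_one_or (Equiv.Perm.sign π) with h1 | h1 <;> simp [h1]
  · rw [Matrix.det_vandermonde_ne_zero_iff]
    intro j j' hjj
    exact hw (sum_X_injective hjj)

/-- Integer version: the Frobenius evaluation determinant of a compressed row family is a nonzero integer polynomial. -/
theorem det_frob_int_ne_zero_of_compressed (u w : Fin r → Finset (Fin h)) (hu : Function.Injective u)
    (hw : Function.Injective w) (e : Fin h → ℕ) (he : Function.Injective e) (hlt : ∀ i, ∑ b ∈ u i, 2 ^ e b < r) :
    (Matrix.of fun i j : Fin r => ∏ b ∈ u i, ∑ γ ∈ w j, (X γ : MvPolynomial (Fin h) ℤ) ^ 2 ^ e b).det ≠ 0 := by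
  intro h0
  apply det_frob_zmod2_ne_zero_of_compressed u w hu hw e he hlt
  have := congr_arg (MvPolynomial.map (Int.castRingHom (ZMod 2))) h0
  rw [map_zero, RingHom.map_det, RingHom.mapMatrix_apply, frobMatrix_map] at this
  convert this using 3
  ext i j
  simp

/-- Some integer point makes the Frobenius evaluation matrix of a compressed row family nonsingular. -/
theorem exists_int_point_of_compressed (u w : Fin r → Finset (Fin h)) (hu : Function.Injective u)
    (hw : Function.Injective w) (e : Fin h → ℕ) (he : Function.Injective e) (hlt : ∀ i, ∑ b ∈ u i, 2 ^ e b < r) :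
    ∃ z : Fin h → ℤ, (Matrix.of fun i j : Fin r => ∏ b ∈ u i, ∑ γ ∈ w j, z γ ^ 2 ^ e b).det ≠ 0 := by
  by_contra hcon
  push Not at hcon
  apply det_frob_int_ne_zero_of_compressed u w hu hw e he hlt
  apply MvPolynomial.funext
  intro z
  rw [map_zero, RingHom.map_det, RingHom.mapMatrix_apply, frobMatrix_map]
  have hz := hcon z
  convert hz using 3
  ext i j
  simp

/-- A complex evaluation point for a compressed row family: some `θ` makes `(∏_{b ∈ u i} Σ_{γ ∈ w j} θ_{bγ})` nonsingular. -/
theorem exists_evalDet_ne_zero_of_compressed (u w : Fin r → Finset (Fin h)) (hu : Function.Injective u)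
    (hw : Function.Injective w) (e : Fin h → ℕ) (he : Function.Injective e) (hlt : ∀ i, ∑ b ∈ u i, 2 ^ e b < r) :
    ∃ θ : Fin h → Fin h → ℂ, (Matrix.of fun i j : Fin r => ∏ b ∈ u i, ∑ γ ∈ w j, θ b γ).det ≠ 0 := by
  obtain ⟨z, hz⟩ := exists_int_point_of_compressed u w hu hw e he hlt
  refine ⟨fun b γ => ((z γ : ℂ)) ^ 2 ^ e b, ?_⟩
  have hmap : (Matrix.of fun i j : Fin r => ∏ b ∈ u i, ∑ γ ∈ w j, ((z γ : ℂ)) ^ 2 ^ e b) =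
      (Matrix.of fun i j : Fin r => ∏ b ∈ u i, ∑ γ ∈ w j, z γ ^ 2 ^ e b).map (Int.castRingHom ℂ) := by
    rw [frobMatrix_map]; rfl
  rw [hmap, ← RingHom.mapMatrix_apply, ← RingHom.map_det]
  exact fun h0 => hz ((Int.castRingHom ℂ).injective_int (h0.trans (map_zero _).symm))

end EvalGP

open EvalGP in
/-- **EVERY PAIR WITH COMPRESSED ROWS IS HIT.** If the row family `u` (injective, any family of faces) is compressed — an initial segment of
colex for some injective vertex labelling `e`, i.e. `Σ_{b ∈ u i} 2^{e b} < r` for all `i` — and `w` is an injective LOWER column family of the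
same size, then `symbolicDet s h r u w ≠ 0` for every `s ≥ 1` (evaluation door, Frobenius–Vandermonde mod 2). -/
theorem symbolicDet_ne_zero_of_compressed {s h r : ℕ} (hs : 1 ≤ s) (u w : Fin r → Finset (Fin h))
    (hu : Function.Injective u) (hw : Function.Injective w) (hlw : IsLowerSet (Set.range w))
    (e : Fin h → ℕ) (he : Function.Injective e) (hlt : ∀ i, ∑ b ∈ u i, 2 ^ e b < r) : symbolicDet s h r u w ≠ 0 := by
  obtain ⟨θ, hθ⟩ := exists_evalDet_ne_zero_of_compressed u w hu hw e he hlt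
  exact EvalDoor.symbolicDet_ne_zero_of_evalDet hs u w hw hlw θ hθ

/-- **EVERY PAIR WITH COMPRESSED COLUMNS IS HIT** (swapped orientation: lower rows, compressed columns). -/
theorem symbolicDet_ne_zero_of_compressed_swap {s h r : ℕ} (hs : 1 ≤ s) (u w : Fin r → Finset (Fin h))
    (hu : Function.Injective u) (hw : Function.Injective w) (hlu : IsLowerSet (Set.range u))
    (e : Fin h → ℕ) (he : Function.Injective e) (hlt : ∀ j, ∑ d ∈ w j, 2 ^ e d < r) : symbolicDet s h r u w ≠ 0 :=
  symbolicDet_ne_zero_swap s h r u w (symbolicDet_ne_zero_of_compressed hs w u hw hu hlu e he hlt)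

/-- **Complex form:** a compressed row family against any injective lower column family of the same size carries a member of 𝔄_s with nonzero
partition minor. -/
theorem anchoredHit_of_compressed {s h r : ℕ} (hs : 1 ≤ s) (u w : Fin r → Finset (Fin h))
    (hu : Function.Injective u) (hw : Function.Injective w) (hlw : IsLowerSet (Set.range w))
    (e : Fin h → ℕ) (he : Function.Injective e) (hlt : ∀ i, ∑ b ∈ u i, 2 ^ e b < r) : AnchoredHit s h r u w :=
  stub_genericPoint s h r u w (symbolicDet_ne_zero_of_compressed hs u w hu hw hlw e he hlt)

/-! ## The general mod-2 criterion (appended, val-np-p1 g30)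

For ANY injective labelling `e` and ANY row family: if the Frobenius evaluation matrix `((Σ_{γ ∈ w j} X_γ) ^ (Σ_{b ∈ u i} 2^{e b}))_{i j}` over
`𝔽₂[X]` — a generalised Vandermonde in the subset-sum linear forms with exponent set `{Σ_{b∈u i} 2^{e b}}` — has nonzero determinant, then the pair is hit at
every profile. This is the reusable interface behind `…_of_compressed` (where the matrix is an honest Vandermonde): a pair can now be certified by
showing that ONE generalised Vandermonde / Schur polynomial in linear forms is nonzero mod 2 (by structure, or by computation). -/

namespace EvalGP

variable {h r : ℕ}

/-- **Mod-2 criterion, polynomial form.** If `det ((Σ_{γ∈w j} X_γ)^(Σ_{b∈u i} 2^{e b})) ≠ 0` in `𝔽₂[X]`, then some integer point makes the evaluation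
matrix `(∏_{b ∈ u i} Σ_{γ ∈ w j} z_γ^{2^{e b}})` nonsingular. (Frobenius collapses the entry mod 2; an integer polynomial with nonzero reduction is nonzero;
`ℤ` is an infinite domain.) -/
theorem exists_int_point_of_frob_det_ne_zero (u w : Fin r → Finset (Fin h)) (e : Fin h → ℕ)
    (hdet : (Matrix.of fun i j : Fin r =>
      (∑ γ ∈ w j, (X γ : MvPolynomial (Fin h) (ZMod 2))) ^ (∑ b ∈ u i, 2 ^ e b)).det ≠ 0) :
    ∃ z : Fin h → ℤ, (Matrix.of fun i j : Fin r => ∏ b ∈ u i, ∑ γ ∈ w j, z γ ^ 2 ^ e b).det ≠ 0 := by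
  -- the `𝔽₂[X]` Frobenius matrix equals the collapsed one
  have hfrob : (Matrix.of fun i j : Fin r => ∏ b ∈ u i, ∑ γ ∈ w j, (X γ : MvPolynomial (Fin h) (ZMod 2)) ^ 2 ^ e b).det ≠ 0 := by
    have hM : (Matrix.of fun i j : Fin r => ∏ b ∈ u i, ∑ γ ∈ w j, (X γ : MvPolynomial (Fin h) (ZMod 2)) ^ 2 ^ e b) =
        Matrix.of fun i j : Fin r => (∑ γ ∈ w j, (X γ : MvPolynomial (Fin h) (ZMod 2))) ^ (∑ b ∈ u i, 2 ^ e b) := by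
      ext i j
      rw [Matrix.of_apply, Matrix.of_apply, frobEntry_charTwo]
    rw [hM]; exact hdet
  -- hence the integer polynomial is nonzero
  have hint : (Matrix.of fun i j : Fin r => ∏ b ∈ u i, ∑ γ ∈ w j, (X γ : MvPolynomial (Fin h) ℤ) ^ 2 ^ e b).det ≠ 0 := by
    intro h0
    apply hfrob
    have := congr_arg (MvPolynomial.map (Int.castRingHom (ZMod 2))) h0
    rw [map_zero, RingHom.map_det, RingHom.mapMatrix_apply, frobMatrix_map] at this
    convert this using 3
    ext i j
    simp
  -- hence an integer point exists
  by_contra hcon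
  push Not at hcon
  apply hint
  apply MvPolynomial.funext
  intro z
  rw [map_zero, RingHom.map_det, RingHom.mapMatrix_apply, frobMatrix_map]
  have hz := hcon z
  convert hz using 3
  ext i j
  simp

end EvalGP

open EvalGP in
/-- **THE MOD-2 CRITERION FOR A PAIR.** For any row family `u`, any injective LOWER column family `w` of the same size and any labelling `e` of the row
vertices: if the generalised Vandermonde `det ((Σ_{γ ∈ w j} X_γ) ^ (Σ_{b ∈ u i} 2^{e b}))_{i j}` is nonzero in `𝔽₂[X]`, then `symbolicDet s h r u w ≠ 0` for every
`s ≥ 1` (evaluation door at the binary point, `EvalDoor.symbolicDet_ne_zero_of_evalDet`). -/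
theorem symbolicDet_ne_zero_of_frob_det_ne_zero {s h r : ℕ} (hs : 1 ≤ s) (u w : Fin r → Finset (Fin h))
    (hw : Function.Injective w) (hlw : IsLowerSet (Set.range w)) (e : Fin h → ℕ)
    (hdet : (Matrix.of fun i j : Fin r =>
      (∑ γ ∈ w j, (X γ : MvPolynomial (Fin h) (ZMod 2))) ^ (∑ b ∈ u i, 2 ^ e b)).det ≠ 0) :
    symbolicDet s h r u w ≠ 0 := by
  obtain ⟨z, hz⟩ := exists_int_point_of_frob_det_ne_zero u w e hdet
  have hmap : (Matrix.of fun i j : Fin r => ∏ b ∈ u i, ∑ γ ∈ w j, ((z γ : ℂ)) ^ 2 ^ e b) =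
      (Matrix.of fun i j : Fin r => ∏ b ∈ u i, ∑ γ ∈ w j, z γ ^ 2 ^ e b).map (Int.castRingHom ℂ) := by
    rw [frobMatrix_map]; rfl
  refine EvalDoor.symbolicDet_ne_zero_of_evalDet hs u w hw hlw (fun b γ => ((z γ : ℂ)) ^ 2 ^ e b) ?_
  rw [hmap, ← RingHom.mapMatrix_apply, ← RingHom.map_det]
  exact fun h0 => hz ((Int.castRingHom ℂ).injective_int (h0.trans (map_zero _).symm))

/-- **Swapped mod-2 criterion** (column family arbitrary, row family injective lower, labelling of the column vertices). -/
theorem symbolicDet_ne_zero_of_frob_det_ne_zero_swap {s h r : ℕ} (hs : 1 ≤ s) (u w : Fin r → Finset (Fin h))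
    (hu : Function.Injective u) (hlu : IsLowerSet (Set.range u)) (e : Fin h → ℕ)
    (hdet : (Matrix.of fun i j : Fin r =>
      (∑ a ∈ u j, (X a : MvPolynomial (Fin h) (ZMod 2))) ^ (∑ d ∈ w i, 2 ^ e d)).det ≠ 0) :
    symbolicDet s h r u w ≠ 0 :=
  symbolicDet_ne_zero_swap s h r u w (symbolicDet_ne_zero_of_frob_det_ne_zero hs w u hu hlu e hdet)

end

end Summit.ValiantsHypothesis.ValiantsHypothesis.Theorems.BarrierLever.AnchoredPeeling
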